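import Mathlib
import Summits.ValiantsHypothesis.ValiantsHypothesis.Theorems.GeneratorObstructionsPowGenDegreeQPGadgetTableauRegroup

/-!
# Route GeneratorObstructions — crux K2 `PowGenDegreeQP` (stmt-ValiantsHypothesis-11655), line
# `trace-side-regimes`: the signed count of the gadget tableau (step R3, the regrouping)

Last combinatorial step of the explicit tableau certificate at the canonical doubling gadget
(blueprint memo `evidence-11655-leafhand3-g5.md` on the item).  After `gadgetTab_count_eq_fiberSum`
(R1) and `valid_all_iff_copies` (R2) the valid signed count of `gadgetTab k c` is a sum over tuples
`ρ` of permutations of the block fibres of the columns, of `∏ sign` times the indicator that every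
copy `(j,q)` satisfies the `D*` condition `blockExpo k (tripleσ ρ j q) (pairτ ρ j q) = blockTgt k`.
Here the sum is regrouped: `grp` (the copy a (column, block) pair belongs to, or `none` for an empty
fibre; each group `≃ Fin 3k ⊕ Fin 3k`, `grpEquiv`), `summand_eq_prod_grpF` (the summand is a product
over groups of factors of the restrictions, so `sum_pi_prod_fiberwise` applies), `sum_grpF_none`
(empty fibres give `1`), `sum_grpF_some` (each copy gives `blockSum k`, transport along
`fibreEquivTriple` / `fibreEquivPair`), and finally `gadgetTab_fiberSum_eq_pow` / `gadgetTab_count`: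
**the valid signed count of the gadget tableau is `blockSum k ^ (2^c - 1)`**.

Honest framing: combinatorics of one explicit tableau; no stub, crux or summit is settled in this
file; `VP ≠ VNP` untouched. [folklore]
-/

namespace Summit.ValiantsHypothesis.ValiantsHypothesis.Theorems.GeneratorObstructions.PowGenDegreeQP

open Literature.Computability.AlgebraicComplexity Literature.Computability.AlgebraicComplexity.TableauEval

-- `Summit.ValiantsHypothesis.ValiantsHypothesis.…` is the tree's mandated single-conjunct layout.
set_option linter.dupNamespace false

noncomputable section

variable {σ : Type*}

/-- `n < 3k·2^j ⟹ n / 3k < 2^j`. [folklore] -/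
theorem div_lt_two_pow_of_lt {k j n : ℕ} (hk : 1 ≤ k) (h : n < 3 * k * 2 ^ j) : n / (3 * k) < 2 ^ j := by
  rw [Nat.div_lt_iff_lt_mul (by omega)]
  linarith

/-- `3k·2^j ≤ n < 3k·2^{j+1} ⟹ (n - 3k·2^j) / 3k < 2^j`. [folklore] -/
theorem sub_div_lt_two_pow {k j n : ℕ} (hk : 1 ≤ k) (h : n < 3 * k * 2 ^ (j + 1)) :
    (n - 3 * k * 2 ^ j) / (3 * k) < 2 ^ j := by
  rw [Nat.div_lt_iff_lt_mul (by omega)]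
  have e1 : 3 * k * 2 ^ (j + 1) = 2 * (3 * k * 2 ^ j) := by ring
  have e2 : 2 ^ j * (3 * k) = 3 * k * 2 ^ j := by ring
  omega

/-- `(3kq + i) / 3k = q` for `i < 3k`. [folklore] -/
theorem tripleCol_div {k q i : ℕ} (hi : i < 3 * k) : (3 * k * q + i) / (3 * k) = q := by
  rw [show 3 * k * q + i = i + 3 * k * q by ring, Nat.add_mul_div_left _ _ (by omega),
    Nat.div_eq_of_lt hi, zero_add]

/-- Bounds recovered from `n / 3k = q`. [folklore] -/
theorem bounds_of_div_eq {k q n : ℕ} (hk : 1 ≤ k) (h : n / (3 * k) = q) :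
    3 * k * q ≤ n ∧ n < 3 * k * q + 3 * k := by
  have h1 := Nat.div_add_mod n (3 * k)
  have h2 := Nat.mod_lt n (show 0 < 3 * k by omega)
  rw [h] at h1
  omega

variable (k c : ℕ) (hk : 1 ≤ k) (hc : 1 ≤ c) (x : ℕ → σ)

/-- The (column, block) pairs of the gadget tableau. [folklore] -/
abbrev ColBlock : Type := (_ : Fin (gadgetTab k c hk hc x).C) × Fin c

/-- The permutations of the block-`p.2` fibre of column `p.1`. [folklore] -/
abbrev FibPerm (p : ColBlock k c hk hc x) : Type :=
  Equiv.Perm {r : Fin ((gadgetTab k c hk hc x).h p.1) // rowBlock k c hk hc x p.1 r = p.2}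

/-- **The group map**: the copy `(j,q)` a (column, block-`j`) pair belongs to — triple column
`3kq + i` (`n < 3k·2^j`), pair column `3k·2^j + 3kq + i` (`3k·2^j ≤ n < 3k·2^{j+1}`) — or `none`
(empty fibre). [folklore] -/
def grp (p : ColBlock k c hk hc x) : Option ((j : Fin c) × Fin (2 ^ j.val)) :=
  if h₁ : p.1.val < 3 * k * 2 ^ p.2.val then
    some ⟨p.2, ⟨p.1.val / (3 * k), div_lt_two_pow_of_lt hk h₁⟩⟩
  else if h₂ : p.1.val < 3 * k * 2 ^ (p.2.val + 1) then
    some ⟨p.2, ⟨(p.1.val - 3 * k * 2 ^ p.2.val) / (3 * k), sub_div_lt_two_pow hk h₂⟩⟩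
  else none

variable {k c hk hc x}

/-- Equality in `ColBlock` from equality of the components. [folklore] -/
theorem colBlock_ext {a b : ColBlock k c hk hc x} (h1 : a.1 = b.1) (h2 : a.2 = b.2) : a = b := by
  obtain ⟨a1, a2⟩ := a
  obtain ⟨b1, b2⟩ := b
  simp only at h1 h2
  subst h1; subst h2; rfl

/-- What `grp p = some ⟨j, q⟩` says about `p`. [folklore] -/
theorem of_grp_eq_some {p : ColBlock k c hk hc x} {jq : (j : Fin c) × Fin (2 ^ j.val)}
    (h : grp k c hk hc x p = some jq) :
    p.2 = jq.1 ∧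
      ((p.1.val < 3 * k * 2 ^ jq.1.val ∧ 3 * k * jq.2.val ≤ p.1.val ∧
          p.1.val < 3 * k * jq.2.val + 3 * k) ∨
        (¬ p.1.val < 3 * k * 2 ^ jq.1.val ∧ p.1.val < 3 * k * 2 ^ (jq.1.val + 1) ∧
          3 * k * 2 ^ jq.1.val + 3 * k * jq.2.val ≤ p.1.val ∧
          p.1.val < 3 * k * 2 ^ jq.1.val + 3 * k * jq.2.val + 3 * k)) := by
  obtain ⟨j, q⟩ := jq
  unfold grp at h
  split_ifs at h with h₁ h₂
  · simp only [Option.some.injEq, Sigma.mk.injEq] at h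
    obtain ⟨hj, hq⟩ := h
    subst hj
    simp only [heq_eq_eq] at hq
    have hqv : p.1.val / (3 * k) = q.val := by rw [← hq]
    have hb := bounds_of_div_eq hk hqv
    exact ⟨rfl, Or.inl ⟨h₁, hb.1, hb.2⟩⟩
  · simp only [Option.some.injEq, Sigma.mk.injEq] at h
    obtain ⟨hj, hq⟩ := h
    subst hj
    simp only [heq_eq_eq] at hq
    have hqv : (p.1.val - 3 * k * 2 ^ p.2.val) / (3 * k) = q.val := by rw [← hq]
    have hb := bounds_of_div_eq hk hqv
    refine ⟨rfl, Or.inr ⟨h₁, h₂, ?_, ?_⟩⟩ <;> dsimp only <;> omega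

/-- `grp p = none` forces `3k·2^{j+1} ≤ n`. [folklore] -/
theorem le_of_grp_eq_none {p : ColBlock k c hk hc x} (h : grp k c hk hc x p = none) :
    3 * k * 2 ^ (p.2.val + 1) ≤ p.1.val := by
  unfold grp at h
  split_ifs at h with h₁ h₂
  omega

variable (k c hk hc x)

/-- The triple column `3kq + i` of copy `(j,q)`, as a member of its group. [folklore] -/
def triP (jq : (j : Fin c) × Fin (2 ^ j.val)) (i : Fin (3 * k)) :
    {p : ColBlock k c hk hc x // grp k c hk hc x p = some jq} :=
  ⟨⟨⟨3 * k * jq.2.val + i.val, (tripleCol_lt jq.1.isLt jq.2.isLt i.isLt).1⟩, jq.1⟩, by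
    unfold grp
    rw [dif_pos (tripleCol_lt jq.1.isLt jq.2.isLt i.isLt).2, Option.some.injEq]
    exact Sigma.ext rfl (heq_of_eq (Fin.ext (tripleCol_div i.isLt)))⟩

/-- The pair column `3k·2^j + 3kq + i` of copy `(j,q)`, as a member of its group. [folklore] -/
def pairP (jq : (j : Fin c) × Fin (2 ^ j.val)) (i : Fin (3 * k)) :
    {p : ColBlock k c hk hc x // grp k c hk hc x p = some jq} :=
  ⟨⟨⟨3 * k * 2 ^ jq.1.val + 3 * k * jq.2.val + i.val, (pairCol_lt jq.1.isLt jq.2.isLt i.isLt).1⟩,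
    jq.1⟩, by
    unfold grp
    rw [dif_neg (by simp only; omega), dif_pos (pairCol_lt jq.1.isLt jq.2.isLt i.isLt).2.2,
      Option.some.injEq]
    refine Sigma.ext rfl (heq_of_eq (Fin.ext ?_))
    change (3 * k * 2 ^ jq.1.val + 3 * k * jq.2.val + i.val - 3 * k * 2 ^ jq.1.val) / (3 * k) =
      jq.2.val
    rw [show 3 * k * 2 ^ jq.1.val + 3 * k * jq.2.val + i.val - 3 * k * 2 ^ jq.1.val =
      3 * k * jq.2.val + i.val by omega]
    exact tripleCol_div i.isLt⟩

/-- **Each group is `Fin 3k ⊕ Fin 3k`** (triple columns, pair columns). [folklore] -/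
def grpEquiv (jq : (j : Fin c) × Fin (2 ^ j.val)) :
    {p : ColBlock k c hk hc x // grp k c hk hc x p = some jq} ≃ Fin (3 * k) ⊕ Fin (3 * k) where
  toFun p :=
    if h : p.1.1.val < 3 * k * 2 ^ jq.1.val then
      Sum.inl ⟨p.1.1.val - 3 * k * jq.2.val, by
        rcases (of_grp_eq_some p.2).2 with ⟨-, -, h3⟩ | ⟨h1, -⟩
        · omega
        · exact absurd h h1⟩
    else
      Sum.inr ⟨p.1.1.val - 3 * k * 2 ^ jq.1.val - 3 * k * jq.2.val, by
        rcases (of_grp_eq_some p.2).2 with ⟨h1, -⟩ | ⟨-, -, -, h4⟩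
        · exact absurd h1 h
        · omega⟩
  invFun := Sum.elim (triP k c hk hc x jq) (pairP k c hk hc x jq)
  left_inv p := by
    obtain ⟨⟨n, j'⟩, hp⟩ := p
    obtain ⟨hj, hcase⟩ := of_grp_eq_some hp
    simp only at hj hcase
    subst hj
    apply Subtype.ext
    simp only
    split_ifs with h
    · rcases hcase with ⟨-, h2, -⟩ | ⟨h1, -⟩
      · simp only [Sum.elim_inl, triP]
        exact colBlock_ext (Fin.ext (by simp only; omega)) rfl
      · exact absurd h h1
    · rcases hcase with ⟨h1, -⟩ | ⟨-, -, h3, -⟩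
      · exact absurd h1 h
      · simp only [Sum.elim_inr, pairP]
        exact colBlock_ext (Fin.ext (by simp only; omega)) rfl
  right_inv s := by
    rcases s with i | i
    · simp only [Sum.elim_inl, triP]
      rw [dif_pos (tripleCol_lt jq.1.isLt jq.2.isLt i.isLt).2]
      congr 1
      exact Fin.ext (by simp only; omega)
    · simp only [Sum.elim_inr, pairP]
      rw [dif_neg (by omega)]
      congr 1
      exact Fin.ext (by simp only; omega)

/-- `(grpEquiv jq).symm (inl i)` is the triple column. [folklore] -/
@[simp] theorem grpEquiv_symm_inl (jq : (j : Fin c) × Fin (2 ^ j.val)) (i : Fin (3 * k)) :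
    (grpEquiv k c hk hc x jq).symm (Sum.inl i) = triP k c hk hc x jq i := rfl

/-- `(grpEquiv jq).symm (inr i)` is the pair column. [folklore] -/
@[simp] theorem grpEquiv_symm_inr (jq : (j : Fin c) × Fin (2 ^ j.val)) (i : Fin (3 * k)) :
    (grpEquiv k c hk hc x jq).symm (Sum.inr i) = pairP k c hk hc x jq i := rfl

/-- The transported triple permutations of a group tuple. [folklore] -/
def σOf (jq : (j : Fin c) × Fin (2 ^ j.val))
    (y : (p : {p : ColBlock k c hk hc x // grp k c hk hc x p = some jq}) → FibPerm k c hk hc x p.1) :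
    Fin (3 * k) → Equiv.Perm (Fin 3) :=
  fun i => (fibreEquivTriple k c hk hc x
      ⟨3 * k * jq.2.val + i.val, (tripleCol_lt jq.1.isLt jq.2.isLt i.isLt).1⟩ jq.1
      (tripleCol_lt jq.1.isLt jq.2.isLt i.isLt).2).permCongr (y (triP k c hk hc x jq i))

/-- The transported pair permutations of a group tuple. [folklore] -/
def τOf (jq : (j : Fin c) × Fin (2 ^ j.val))
    (y : (p : {p : ColBlock k c hk hc x // grp k c hk hc x p = some jq}) → FibPerm k c hk hc x p.1) :
    Fin (3 * k) → Equiv.Perm (Fin 2) :=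
  fun i => (fibreEquivPair k c hk hc x
      ⟨3 * k * 2 ^ jq.1.val + 3 * k * jq.2.val + i.val, (pairCol_lt jq.1.isLt jq.2.isLt i.isLt).1⟩
      jq.1 (pairCol_lt jq.1.isLt jq.2.isLt i.isLt).2.1
      (pairCol_lt jq.1.isLt jq.2.isLt i.isLt).2.2).permCongr (y (pairP k c hk hc x jq i))

/-- `σOf` of a restricted tuple is `tripleσ`. [folklore] -/
theorem σOf_restrict (jq : (j : Fin c) × Fin (2 ^ j.val)) (ρ : (p : ColBlock k c hk hc x) → FibPerm k c hk hc x p) :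
    σOf k c hk hc x jq (fun p => ρ p.1) = tripleσ k c hk hc x (Sigma.curry ρ) jq.1 jq.2.val jq.2.isLt := rfl

/-- `τOf` of a restricted tuple is `pairτ`. [folklore] -/
theorem τOf_restrict (jq : (j : Fin c) × Fin (2 ^ j.val)) (ρ : (p : ColBlock k c hk hc x) → FibPerm k c hk hc x p) :
    τOf k c hk hc x jq (fun p => ρ p.1) = pairτ k c hk hc x (Sigma.curry ρ) jq.1 jq.2.val jq.2.isLt := rfl

/-- The indicator factor of a group: the `D*` condition of the copy (none for empty fibres).
[folklore] -/
def grpInd : (γ : Option ((j : Fin c) × Fin (2 ^ j.val))) →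
    ((p : {p : ColBlock k c hk hc x // grp k c hk hc x p = γ}) → FibPerm k c hk hc x p.1) → ℂ
  | none, _ => 1
  | some jq, y => if blockExpo k (σOf k c hk hc x jq y) (τOf k c hk hc x jq y) = blockTgt k then 1 else 0

/-- The factor of a group: signs times indicator. [folklore] -/
def grpF (γ : Option ((j : Fin c) × Fin (2 ^ j.val)))
    (y : (p : {p : ColBlock k c hk hc x // grp k c hk hc x p = γ}) → FibPerm k c hk hc x p.1) : ℂ :=
  (∏ p, ((Equiv.Perm.sign (y p) : ℤ) : ℂ)) * grpInd k c hk hc x γ y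

/-- **The summand is the product of the group factors.** [folklore] -/
theorem summand_eq_prod_grpF (ρ : (p : ColBlock k c hk hc x) → FibPerm k c hk hc x p) :
    (∏ n, ∏ j, ((Equiv.Perm.sign ((Sigma.curry ρ : (n : Fin (gadgetTab k c hk hc x).C) →
        (j : Fin c) → Equiv.Perm {r : Fin ((gadgetTab k c hk hc x).h n) //
          rowBlock k c hk hc x n r = j}) n j) : ℤ) : ℂ)) *
        (if ∀ jq : (j : Fin c) × Fin (2 ^ j.val),
            blockExpo k (tripleσ k c hk hc x (Sigma.curry ρ) jq.1 jq.2.val jq.2.isLt)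
              (pairτ k c hk hc x (Sigma.curry ρ) jq.1 jq.2.val jq.2.isLt) = blockTgt k then 1 else 0) =
      ∏ γ, grpF k c hk hc x γ (fun p => ρ p.1) := by
  classical
  -- signs
  have hsgn : (∏ n, ∏ j, ((Equiv.Perm.sign ((Sigma.curry ρ : (n : Fin (gadgetTab k c hk hc x).C) →
        (j : Fin c) → Equiv.Perm {r : Fin ((gadgetTab k c hk hc x).h n) //
          rowBlock k c hk hc x n r = j}) n j) : ℤ) : ℂ)) =
      ∏ γ, ∏ p : {p : ColBlock k c hk hc x // grp k c hk hc x p = γ},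
        ((Equiv.Perm.sign (ρ p.1) : ℤ) : ℂ) := by
    rw [Fintype.prod_fiberwise (grp k c hk hc x) (fun p => ((Equiv.Perm.sign (ρ p) : ℤ) : ℂ)),
      Fintype.prod_sigma (fun p => ((Equiv.Perm.sign (ρ p) : ℤ) : ℂ))]
    rfl
  -- indicator
  have hind : (if ∀ jq : (j : Fin c) × Fin (2 ^ j.val),
        blockExpo k (tripleσ k c hk hc x (Sigma.curry ρ) jq.1 jq.2.val jq.2.isLt)
          (pairτ k c hk hc x (Sigma.curry ρ) jq.1 jq.2.val jq.2.isLt) = blockTgt k then (1 : ℂ) else 0) =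
      ∏ γ, grpInd k c hk hc x γ (fun p => ρ p.1) := by
    rw [Fintype.prod_option]
    change _ = 1 * ∏ jq, (if blockExpo k (σOf k c hk hc x jq (fun p => ρ p.1))
      (τOf k c hk hc x jq (fun p => ρ p.1)) = blockTgt k then (1 : ℂ) else 0)
    rw [one_mul, Fintype.prod_boole]
    rfl
  rw [hsgn, hind, ← Finset.prod_mul_distrib]
  rfl

/-- **Empty fibres contribute `1`.** [folklore] -/
theorem sum_grpF_none :
    (∑ y : (p : {p : ColBlock k c hk hc x // grp k c hk hc x p = none}) → FibPerm k c hk hc x p.1,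
      grpF k c hk hc x none y) = 1 := by
  classical
  have hE : ∀ p : {p : ColBlock k c hk hc x // grp k c hk hc x p = none},
      IsEmpty {r : Fin ((gadgetTab k c hk hc x).h p.1.1) // rowBlock k c hk hc x p.1.1 r = p.1.2} :=
    fun p => fibre_isEmpty k c hk hc x p.1.1 p.1.2 (le_of_grp_eq_none p.2)
  have hU : ∀ y : (p : {p : ColBlock k c hk hc x // grp k c hk hc x p = none}) →
      FibPerm k c hk hc x p.1, y = fun _ => 1 := by
    intro y
    funext p
    haveI := hE p
    exact Subsingleton.elim _ _
  haveI : Subsingleton ((p : {p : ColBlock k c hk hc x // grp k c hk hc x p = none}) →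
      FibPerm k c hk hc x p.1) := ⟨fun a b => by rw [hU a, hU b]⟩
  rw [Fintype.sum_subsingleton _ (fun _ => 1)]
  simp [grpF, grpInd]

/-- The tuples of a copy group are pairs (triple permutations, pair permutations). [folklore] -/
def grpTupleEquiv (jq : (j : Fin c) × Fin (2 ^ j.val)) :
    ((p : {p : ColBlock k c hk hc x // grp k c hk hc x p = some jq}) → FibPerm k c hk hc x p.1) ≃
      (Fin (3 * k) → Equiv.Perm (Fin 3)) × (Fin (3 * k) → Equiv.Perm (Fin 2)) :=
  (Equiv.piCongrLeft' (fun p : {p : ColBlock k c hk hc x // grp k c hk hc x p = some jq} =>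
      FibPerm k c hk hc x p.1) (grpEquiv k c hk hc x jq)).trans
    ((Equiv.sumPiEquivProdPi (fun s : Fin (3 * k) ⊕ Fin (3 * k) =>
        FibPerm k c hk hc x ((grpEquiv k c hk hc x jq).symm s).1)).trans
      (Equiv.prodCongr
        (Equiv.piCongrRight fun i : Fin (3 * k) =>
          show FibPerm k c hk hc x (triP k c hk hc x jq i).1 ≃ Equiv.Perm (Fin 3) from
            (fibreEquivTriple k c hk hc x
              ⟨3 * k * jq.2.val + i.val, (tripleCol_lt jq.1.isLt jq.2.isLt i.isLt).1⟩ jq.1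
              (tripleCol_lt jq.1.isLt jq.2.isLt i.isLt).2).permCongr)
        (Equiv.piCongrRight fun i : Fin (3 * k) =>
          show FibPerm k c hk hc x (pairP k c hk hc x jq i).1 ≃ Equiv.Perm (Fin 2) from
            (fibreEquivPair k c hk hc x
              ⟨3 * k * 2 ^ jq.1.val + 3 * k * jq.2.val + i.val,
                (pairCol_lt jq.1.isLt jq.2.isLt i.isLt).1⟩
              jq.1 (pairCol_lt jq.1.isLt jq.2.isLt i.isLt).2.1
              (pairCol_lt jq.1.isLt jq.2.isLt i.isLt).2.2).permCongr)))

/-- Components of `grpTupleEquiv`. [folklore] -/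
theorem grpTupleEquiv_apply (jq : (j : Fin c) × Fin (2 ^ j.val))
    (y : (p : {p : ColBlock k c hk hc x // grp k c hk hc x p = some jq}) → FibPerm k c hk hc x p.1) :
    grpTupleEquiv k c hk hc x jq y = (σOf k c hk hc x jq y, τOf k c hk hc x jq y) := rfl

/-- The sign product of a group tuple splits into triple and pair signs (transport preserves signs).
[folklore] -/
theorem prod_sign_grp (jq : (j : Fin c) × Fin (2 ^ j.val))
    (y : (p : {p : ColBlock k c hk hc x // grp k c hk hc x p = some jq}) → FibPerm k c hk hc x p.1) :
    (∏ p, ((Equiv.Perm.sign (y p) : ℤ) : ℂ)) =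
      (∏ i, ((Equiv.Perm.sign (σOf k c hk hc x jq y i) : ℤ) : ℂ)) *
        ∏ i, ((Equiv.Perm.sign (τOf k c hk hc x jq y i) : ℤ) : ℂ) := by
  rw [← Fintype.prod_equiv (grpEquiv k c hk hc x jq).symm
      (fun s => ((Equiv.Perm.sign (y ((grpEquiv k c hk hc x jq).symm s)) : ℤ) : ℂ))
      (fun p => ((Equiv.Perm.sign (y p) : ℤ) : ℂ)) (fun _ => rfl),
    Fintype.prod_sum_type]
  simp only [grpEquiv_symm_inl, grpEquiv_symm_inr, σOf, τOf, Equiv.Perm.sign_permCongr]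
  rfl

/-- **Each copy contributes `blockSum k`.** [folklore] -/
theorem sum_grpF_some (jq : (j : Fin c) × Fin (2 ^ j.val)) :
    (∑ y : (p : {p : ColBlock k c hk hc x // grp k c hk hc x p = some jq}) → FibPerm k c hk hc x p.1,
      grpF k c hk hc x (some jq) y) = ((blockSum k : ℤ) : ℂ) := by
  classical
  rw [blockSum]
  push_cast
  rw [← Fintype.sum_prod_type' (fun (s : Fin (3 * k) → Equiv.Perm (Fin 3))
      (t : Fin (3 * k) → Equiv.Perm (Fin 2)) =>
      if blockExpo k s t = blockTgt k then
        (∏ i, ((Equiv.Perm.sign (s i) : ℤ) : ℂ)) * ∏ i, ((Equiv.Perm.sign (t i) : ℤ) : ℂ) else 0)]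
  refine Fintype.sum_equiv (grpTupleEquiv k c hk hc x jq) _ _ fun y => ?_
  rw [grpTupleEquiv_apply, grpF, prod_sign_grp]
  simp only [grpInd]
  split_ifs <;> simp

/-- **(R3) The fibrewise signed sum is `blockSum k ^ (2^c - 1)`.** [folklore] -/
theorem gadgetTab_fiberSum_eq_pow [LinearOrder σ] {N : ℕ} (hx : IsAntitoneEnum x N) (hN : 3 * c ≤ N) :
    (∑ ρ : (n : Fin (gadgetTab k c hk hc x).C) → (j : Fin c) →
          Equiv.Perm {r : Fin ((gadgetTab k c hk hc x).h n) // rowBlock k c hk hc x n r = j},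
        (∏ n, ∏ j, ((Equiv.Perm.sign (ρ n j) : ℤ) : ℂ)) *
          (if ∀ u : Fin (gadgetTab k c hk hc x).d,
              (gadgetTab k c hk hc x).content (fiberPermPi (rowBlock k c hk hc x) ρ) u =
                gadgetExp k (fun i : Fin c => x (letterRow c i 2)) (fun i => x (letterRow c i 1))
                  (fun i => x (letterRow c i 0)) ⟨labBlock u, (labBlock_lt u).1⟩
            then 1 else 0)) =
      ((blockSum k : ℤ) : ℂ) ^ (2 ^ c - 1) := by
  classical
  -- uncurry and pass to the copy conditions
  have step1 : (∑ ρ : (n : Fin (gadgetTab k c hk hc x).C) → (j : Fin c) →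
          Equiv.Perm {r : Fin ((gadgetTab k c hk hc x).h n) // rowBlock k c hk hc x n r = j},
        (∏ n, ∏ j, ((Equiv.Perm.sign (ρ n j) : ℤ) : ℂ)) *
          (if ∀ u : Fin (gadgetTab k c hk hc x).d,
              (gadgetTab k c hk hc x).content (fiberPermPi (rowBlock k c hk hc x) ρ) u =
                gadgetExp k (fun i : Fin c => x (letterRow c i 2)) (fun i => x (letterRow c i 1))
                  (fun i => x (letterRow c i 0)) ⟨labBlock u, (labBlock_lt u).1⟩
            then 1 else 0)) =
      ∑ ρ : (p : ColBlock k c hk hc x) → FibPerm k c hk hc x p,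
        (∏ n, ∏ j, ((Equiv.Perm.sign ((Sigma.curry ρ : (n : Fin (gadgetTab k c hk hc x).C) →
            (j : Fin c) → Equiv.Perm {r : Fin ((gadgetTab k c hk hc x).h n) //
              rowBlock k c hk hc x n r = j}) n j) : ℤ) : ℂ)) *
          (if ∀ jq : (j : Fin c) × Fin (2 ^ j.val),
              blockExpo k (tripleσ k c hk hc x (Sigma.curry ρ) jq.1 jq.2.val jq.2.isLt)
                (pairτ k c hk hc x (Sigma.curry ρ) jq.1 jq.2.val jq.2.isLt) = blockTgt k
            then 1 else 0) := by
    refine (Fintype.sum_equiv (Equiv.piCurry fun (n : Fin (gadgetTab k c hk hc x).C) (j : Fin c) =>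
      Equiv.Perm {r : Fin ((gadgetTab k c hk hc x).h n) // rowBlock k c hk hc x n r = j}) _ _
      fun ρ => ?_).symm
    rw [Equiv.piCurry_apply]
    congr 1
    exact if_congr (valid_all_iff_copies k c hk hc x hx hN (Sigma.curry ρ)).symm rfl rfl
  rw [step1, Fintype.sum_congr _ _ (summand_eq_prod_grpF k c hk hc x),
    sum_pi_prod_fiberwise (grp k c hk hc x) (FibPerm k c hk hc x) (grpF k c hk hc x),
    Fintype.prod_option, sum_grpF_none, one_mul, Fintype.prod_congr _ _ (sum_grpF_some k c hk hc x),
    Finset.prod_const, Finset.card_univ, card_copies]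

/-- **The valid signed count of the gadget tableau at the doubling gadget is `blockSum k ^ (2^c-1)`.**
[folklore] -/
theorem gadgetTab_count [LinearOrder σ] {N : ℕ} (hx : IsAntitoneEnum x N) (hN : 3 * c ≤ N) :
    (∑ π : (gadgetTab k c hk hc x).Bij, (((gadgetTab k c hk hc x).sgnProd π : ℤ) : ℂ) *
      (if ∀ u, ∃ j : Fin c, (gadgetTab k c hk hc x).content π u =
          gadgetExp k (fun j : Fin c => x (letterRow c j 2)) (fun j => x (letterRow c j 1))
            (fun j => x (letterRow c j 0)) j then 1 else 0)) =
      ((blockSum k : ℤ) : ℂ) ^ (2 ^ c - 1) := by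
  rw [gadgetTab_count_eq_fiberSum k c hk hc hx hN, gadgetTab_fiberSum_eq_pow k c hk hc x hx hN]

end

end Summit.ValiantsHypothesis.ValiantsHypothesis.Theorems.GeneratorObstructions.PowGenDegreeQP
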